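import Summits.BirchSwinnertonDyer.BirchSwinnertonDyer.Theorems.Rank2ShaKerPolyCert
import Literature.NumberTheory.EllipticCurves.Rank1Residual.GVParityTwistProofs
import Literature.NumberTheory.EllipticCurves.DivisionPolynomialTorsion
import HarnessLib

/-!
# BirchSwinnertonDyer — rank-2 `Ш[p^∞]` cell: kernel-polynomial certificate, II — the evaluation
# semantics of the checker's list arithmetic (`ℚ[X]`, `B = ℚ[X,Y]/(Weierstrass)`, `ℚ[X][T]`) on `E(ℚ̄)`

HONEST FRAMING (cell `b2b-bsdr2sha`, run/shared/lean/b2b/bsd-rank2-sha/, ENGINE 3 = IMC bookkeeping):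
per-pair certified theorems «cited hypotheses ∧ certified computation ⇒ `Ш(E/ℚ)[p^∞]` finite of order
`p^k`»; NO claim on BSD in rank `≥ 2`; nothing about `Ш` here. Companion of `Rank2ShaKerPolyCert.lean`
(the computable checker `KerPoly.Cert.check` of a kernel-polynomial certificate and the evaluation maps
`evalL`, `evalB`, `evalLT`). THIS FILE proves that the list arithmetic MEANS ring arithmetic at a
geometric point: `addL`/`mulL`/… are `+`/`·` under `evalL` (§4), `mulB` is multiplication ON THE CURVE
(`evalB_mulB`, the Weierstrass relation `Y² = F + G·Y` eliminating `Y²`), a certified congruence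
`congB H lhs rhs q` forces `lhs = rhs` at every root of `H` (`congB_sound`), the root test (R) gives
`∏ (t − x_k(x)) = H(t)` (`prod_eq_of_rootsOK`); and the small facts used by the soundness theorem
(`Rank2ShaKerPolyCertSound.lean`): the monic `H` has a root in `ℚ̄` (`exists_root_algClosure`, Mathlib
`IsAlgClosed.exists_aeval_eq_zero`), `Γ_ℚ` commutes with `evalL` and acts on affine points coordinatewise
(`smul_evalL`, `smul_some`), and the Weierstrass equation of `E/ℚ̄` in the form `y² = F(x) + G(x)y`
(`sq_eq_of_equation`). Theorems only; no definition, no named fact, no axiom.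
References: J. H. Silverman, *The Arithmetic of Elliptic Curves*, GTM 106 (2009), III.1–III.2
[SilvermanAEC2009].
-/

set_option autoImplicit false

-- single-conjunct summit: `Summit.BirchSwinnertonDyer.BirchSwinnertonDyer.…` repeats the name by design
set_option linter.dupNamespace false

open WeierstrassCurve Polynomial Literature.NumberTheory.EllipticCurves
  Literature.NumberTheory.EllipticCurves.Rank1Residual Field

namespace Summit.BirchSwinnertonDyer.BirchSwinnertonDyer.Rank2Sha

namespace KerPoly

/-! ### §4. Evaluation semantics of the list arithmetic -/

section Eval

variable {K : Type*} [CommRing K] [Algebra ℚ K]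

/-- `addL` is addition. [folklore] -/
theorem evalL_addL (x : K) : ∀ l₁ l₂ : List ℚ, evalL x (addL l₁ l₂) = evalL x l₁ + evalL x l₂
  | [], l => by simp [addL]
  | a :: l, [] => by simp [addL]
  | a :: l₁, b :: l₂ => by
    rw [addL, evalL_cons, evalL_cons, evalL_cons, evalL_addL x l₁ l₂, map_add]; ring

/-- `smulL` is scalar multiplication. [folklore] -/
theorem evalL_smulL (x : K) (c : ℚ) : ∀ l : List ℚ, evalL x (smulL c l) = algebraMap ℚ K c * evalL x l
  | [] => by simp [smulL]
  | a :: l => by rw [smulL, evalL_cons, evalL_cons, evalL_smulL x c l, map_mul]; ring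

/-- `negL` is negation. [folklore] -/
theorem evalL_negL (x : K) : ∀ l : List ℚ, evalL x (negL l) = -evalL x l
  | [] => by simp [negL]
  | a :: l => by rw [negL, evalL_cons, evalL_cons, evalL_negL x l, map_neg]; ring

/-- `subL` is subtraction. [folklore] -/
theorem evalL_subL (x : K) (l₁ l₂ : List ℚ) : evalL x (subL l₁ l₂) = evalL x l₁ - evalL x l₂ := by
  rw [subL, evalL_addL, evalL_negL, sub_eq_add_neg]

/-- `mulL` is multiplication. [folklore] -/
theorem evalL_mulL (x : K) : ∀ l₁ l₂ : List ℚ, evalL x (mulL l₁ l₂) = evalL x l₁ * evalL x l₂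
  | [], l₂ => by simp [mulL]
  | a :: l₁, l₂ => by
    rw [mulL, evalL_addL, evalL_smulL, evalL_cons, evalL_cons, evalL_mulL x l₁ l₂, map_zero]; ring

/-- A list of zeros evaluates to `0`. [folklore] -/
theorem evalL_eq_zero_of_isZeroL (x : K) : ∀ {l : List ℚ}, isZeroL l = true → evalL x l = 0
  | [], _ => rfl
  | a :: l, h => by
    simp only [isZeroL, Bool.and_eq_true, decide_eq_true_eq] at h
    rw [evalL_cons, h.1, map_zero, evalL_eq_zero_of_isZeroL x h.2, mul_zero, add_zero]

/-- Evaluation of a concatenation. [folklore] -/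
theorem evalL_append (x : K) : ∀ l₁ l₂ : List ℚ,
    evalL x (l₁ ++ l₂) = evalL x l₁ + x ^ l₁.length * evalL x l₂
  | [], l₂ => by simp
  | a :: l₁, l₂ => by
    rw [List.cons_append, evalL_cons, evalL_cons, evalL_append x l₁ l₂, List.length_cons, pow_succ]
    ring

/-- `addB` is addition. [folklore] -/
theorem evalB_addB (x y : K) (b₁ b₂ : B) : evalB x y (addB b₁ b₂) = evalB x y b₁ + evalB x y b₂ := by
  simp only [evalB, addB, evalL_addL]; ring

/-- `negB` is negation. [folklore] -/
theorem evalB_negB (x y : K) (b : B) : evalB x y (negB b) = -evalB x y b := by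
  simp only [evalB, negB, evalL_negL]; ring

/-- `subB` is subtraction. [folklore] -/
theorem evalB_subB (x y : K) (b₁ b₂ : B) : evalB x y (subB b₁ b₂) = evalB x y b₁ - evalB x y b₂ := by
  rw [subB, evalB_addB, evalB_negB, sub_eq_add_neg]

/-- `smulB` is scalar multiplication. [folklore] -/
theorem evalB_smulB (x y : K) (c : ℚ) (b : B) :
    evalB x y (smulB c b) = algebraMap ℚ K c * evalB x y b := by
  simp only [evalB, smulB, evalL_smulL]; ring

/-- `scaleB` is multiplication by a polynomial in `X`. [folklore] -/
theorem evalB_scaleB (x y : K) (q : List ℚ) (b : B) :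
    evalB x y (scaleB q b) = evalL x q * evalB x y b := by
  simp only [evalB, scaleB, evalL_mulL]; ring

/-- `constB c` is the constant `c`. [folklore] -/
@[simp] theorem evalB_constB (x y : K) (c : ℚ) : evalB x y (constB c) = algebraMap ℚ K c := by
  simp [evalB, constB]

/-- `oneB` is `1`. [folklore] -/
@[simp] theorem evalB_oneB (x y : K) : evalB x y oneB = 1 := by
  simp [evalB, oneB]

/-- `PX` is the abscissa. [folklore] -/
@[simp] theorem evalB_PX (x y : K) : evalB x y PX = x := by
  simp [evalB, PX]

/-- `PY` is the ordinate. [folklore] -/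
@[simp] theorem evalB_PY (x y : K) : evalB x y PY = y := by
  simp [evalB, PY]

/-- A pair of zero lists evaluates to `0`. [folklore] -/
theorem evalB_eq_zero_of_isZeroB (x y : K) {b : B} (h : isZeroB b = true) : evalB x y b = 0 := by
  simp only [isZeroB, Bool.and_eq_true] at h
  rw [evalB, evalL_eq_zero_of_isZeroL x h.1, evalL_eq_zero_of_isZeroL x h.2, zero_mul, add_zero]

/-- **`mulB` is multiplication ON THE CURVE**: if `y² = F(x) + G(x)·y` then
`(u₁ + v₁y)(u₂ + v₂y)` evaluates as `mulB`. [folklore] -/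
theorem evalB_mulB (x y : K) (A : Crv) (heq : y ^ 2 = evalL x A.F + evalL x A.G * y) (b₁ b₂ : B) :
    evalB x y (mulB A b₁ b₂) = evalB x y b₁ * evalB x y b₂ := by
  simp only [evalB, mulB, evalL_addL, evalL_mulL]
  linear_combination (-(evalL x b₁.2 * evalL x b₂.2)) * heq

/-- `negYB` is Mathlib's `negY`: `−y − a₁x − a₃`. [folklore] -/
theorem evalB_negYB (x y : K) (A : Crv) (xb yb : B) :
    evalB x y (negYB A xb yb) =
      -evalB x y yb - algebraMap ℚ K A.a₁ * evalB x y xb - algebraMap ℚ K A.a₃ := by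
  simp only [negYB, evalB_subB, evalB_negB, evalB_smulB, evalB_constB]

/-- **Soundness of a certified congruence**: at a root `x` of `H`, `congB H lhs rhs q` forces
`lhs(x, y) = rhs(x, y)`. [folklore] -/
theorem congB_sound (x y : K) {H : List ℚ} (hH : evalL x H = 0) {lhs rhs q : B}
    (h : congB H lhs rhs q = true) : evalB x y lhs = evalB x y rhs := by
  have e := evalB_eq_zero_of_isZeroB x y h
  rw [evalB_subB, evalB_subB, evalB_scaleB, hH, zero_mul, sub_zero] at e
  exact sub_eq_zero.mp e

/-- Negating every `T`-coefficient. [folklore] -/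
theorem evalLT_map_negL (x t : K) : ∀ l : List (List ℚ),
    evalLT x t (l.map negL) = -evalLT x t l
  | [] => by simp
  | d :: ds => by rw [List.map_cons, evalLT_cons, evalLT_cons, evalLT_map_negL x t ds, evalL_negL]; ring

/-- `subLT` is subtraction. [folklore] -/
theorem evalLT_subLT (x t : K) : ∀ l₁ l₂ : List (List ℚ),
    evalLT x t (subLT l₁ l₂) = evalLT x t l₁ - evalLT x t l₂
  | [], l => by rw [subLT, evalLT_map_negL, evalLT_nil, zero_sub]
  | a :: l, [] => by simp [subLT]
  | a :: l₁, b :: l₂ => by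
    rw [subLT, evalLT_cons, evalLT_cons, evalLT_cons, evalLT_subLT x t l₁ l₂, evalL_subL]; ring

/-- Scaling every `T`-coefficient by `u(X)`. [folklore] -/
theorem evalLT_map_mulL (x t : K) (u : List ℚ) : ∀ l : List (List ℚ),
    evalLT x t (l.map (mulL u)) = evalL x u * evalLT x t l
  | [] => by simp
  | d :: ds => by rw [List.map_cons, evalLT_cons, evalLT_cons, evalLT_map_mulL x t u ds, evalL_mulL]; ring

/-- `mulTminus u` is multiplication by `T − u(x)`. [folklore] -/
theorem evalLT_mulTminus (x t : K) (u : List ℚ) (l : List (List ℚ)) :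
    evalLT x t (mulTminus u l) = (t - evalL x u) * evalLT x t l := by
  rw [mulTminus, evalLT_subLT, evalLT_cons, evalLT_map_mulL, evalL_nil]; ring

/-- `prodT us` is `∏ (T − u(x))`. [folklore] -/
theorem evalLT_prodT (x t : K) : ∀ us : List (List ℚ),
    evalLT x t (prodT us) = (us.map fun u => t - evalL x u).prod
  | [] => by simp [prodT]
  | u :: us => by rw [prodT, evalLT_mulTminus, evalLT_prodT x t us, List.map_cons, List.prod_cons]

/-- The constant-coefficient embedding of `H(T)`. [folklore] -/
theorem evalLT_map_singleton (x t : K) : ∀ H : List ℚ,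
    evalLT x t (H.map fun c => [c]) = evalL t H
  | [] => by simp
  | c :: H => by
    rw [List.map_cons, evalLT_cons, evalL_cons, evalLT_map_singleton x t H, evalL_cons, evalL_nil,
      mul_zero, add_zero]

/-- Certified multiples of `H` vanish at a root of `H`. [folklore] -/
theorem evalLT_eq_zero_of_allMulH (x t : K) {H : List ℚ} (hH : evalL x H = 0) :
    ∀ {D qs : List (List ℚ)}, allMulH H D qs = true → evalLT x t D = 0
  | [], [], _ => rfl
  | [], _ :: _, h => by simp [allMulH] at h
  | _ :: _, [], h => by simp [allMulH] at h
  | dj :: D, qj :: qs, h => by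
    simp only [allMulH, Bool.and_eq_true] at h
    have e := evalL_eq_zero_of_isZeroL x h.1
    rw [evalL_subL, evalL_mulL, hH, mul_zero, sub_zero] at e
    rw [evalLT_cons, e, evalLT_eq_zero_of_allMulH x t hH h.2, mul_zero, add_zero]

/-- **Soundness of the root test (R)**: at a root `x` of `H`, `∏_{u} (t − u(x)) = H(t)` for every
`t`. [folklore] -/
theorem prod_eq_of_rootsOK (x t : K) {H : List ℚ} (hH : evalL x H = 0) {us qs : List (List ℚ)}
    (h : rootsOK H us qs = true) : (us.map fun u => t - evalL x u).prod = evalL t H := by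
  have e := evalLT_eq_zero_of_allMulH x t hH h
  rw [evalLT_subLT, evalLT_prodT, evalLT_map_singleton] at e
  exact sub_eq_zero.mp e

end Eval

/-! ### §4b. Small facts for the soundness theorem -/

section Facts

open scoped Classical

variable (W : WeierstrassCurve ℚ)

/-- Two affine points with equal coordinates are equal. [folklore] -/
theorem some_eq_some {F : Type*} [Field F] {V : WeierstrassCurve F} {x y x' y' : F}
    (hx : x = x') (hy : y = y') (h : V.toAffine.Nonsingular x y) (h' : V.toAffine.Nonsingular x' y') :
    (Affine.Point.some x y h : V.toAffine.Point) = Affine.Point.some x' y' h' := by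
  subst hx hy; rfl

/-- In a field, `w · D = 1` gives `N / D = N · w`. [folklore] -/
theorem div_eq_mul_of_mul_eq_one {F : Type*} [Field F] {w D : F} (h : w * D = 1) (N : F) :
    N / D = N * w := by
  have hD : D ≠ 0 := by rintro rfl; simp at h
  rw [div_eq_mul_inv, eq_inv_of_mul_eq_one_left h]

/-- The coefficients of `E/ℚ̄` are those of `E/ℚ`. [folklore] -/
theorem baseChange_a (W : WeierstrassCurve ℚ) :
    (W.baseChange (AlgebraicClosure ℚ)).toAffine.a₁ = algebraMap ℚ _ W.a₁ ∧
    (W.baseChange (AlgebraicClosure ℚ)).toAffine.a₂ = algebraMap ℚ _ W.a₂ ∧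
    (W.baseChange (AlgebraicClosure ℚ)).toAffine.a₃ = algebraMap ℚ _ W.a₃ ∧
    (W.baseChange (AlgebraicClosure ℚ)).toAffine.a₄ = algebraMap ℚ _ W.a₄ ∧
    (W.baseChange (AlgebraicClosure ℚ)).toAffine.a₆ = algebraMap ℚ _ W.a₆ :=
  ⟨rfl, rfl, rfl, rfl, rfl⟩

/-- On `E(ℚ̄)` the Weierstrass equation reads `y² = F(x) + G(x)·y`. [folklore] -/
theorem sq_eq_of_equation {x y : AlgebraicClosure ℚ}
    (h : (W.baseChange (AlgebraicClosure ℚ)).toAffine.Equation x y) :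
    y ^ 2 = evalL x (Crv.of W).F + evalL x (Crv.of W).G * y := by
  obtain ⟨e₁, e₂, e₃, e₄, e₆⟩ := baseChange_a W
  rw [Affine.equation_iff, e₁, e₂, e₃, e₄, e₆] at h
  simp only [Crv.of, Crv.F, Crv.G, evalL_cons, evalL_nil, map_one, map_neg, mul_zero, add_zero]
  linear_combination h


/-- `toPoly l` evaluates as `evalL`. [folklore] -/
theorem aeval_toPoly {K : Type*} [CommRing K] [Algebra ℚ K] (x : K) :
    ∀ l : List ℚ, aeval x (toPoly l) = evalL x l
  | [] => by simp [toPoly]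
  | c :: l => by rw [toPoly, map_add, map_mul, aeval_C, aeval_X, aeval_toPoly x l, evalL_cons]

/-- The coefficients of `toPoly l` vanish from the length of `l` on. [folklore] -/
theorem coeff_toPoly_eq_zero : ∀ (l : List ℚ) (m : ℕ), l.length ≤ m → (toPoly l).coeff m = 0
  | [], m, _ => by simp [toPoly]
  | c :: l, 0, h => by simp at h
  | c :: l, m + 1, h => by
    rw [toPoly, coeff_add, coeff_C_succ, coeff_X_mul, coeff_toPoly_eq_zero l m (by simpa using h),
      add_zero]

/-- `deg (toPoly l) < |l|`. [folklore] -/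
theorem degree_toPoly_lt (l : List ℚ) : (toPoly l).degree < l.length :=
  (degree_lt_iff_coeff_zero _ _).mpr (coeff_toPoly_eq_zero l)

/-- **A monic `H = X^d + Σ hᵢXⁱ` with `d ≥ 1` has a root in `ℚ̄`.** [folklore] -/
theorem exists_root_algClosure (h : List ℚ) (hh : 1 ≤ h.length) :
    ∃ x : AlgebraicClosure ℚ, evalL x (h ++ [1]) = 0 := by
  set HP : ℚ[X] := X ^ h.length + toPoly h with hHP
  have hdeg : HP.degree = h.length := by
    have hX : (X ^ h.length : ℚ[X]).degree = h.length := degree_X_pow _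
    rw [hHP, degree_add_eq_left_of_degree_lt (by rw [hX]; exact degree_toPoly_lt h), hX]
  have hne : HP.degree ≠ 0 := by
    rw [hdeg]; exact_mod_cast (by omega : h.length ≠ 0)
  obtain ⟨x, hx⟩ := IsAlgClosed.exists_aeval_eq_zero (AlgebraicClosure ℚ) HP hne
  refine ⟨x, ?_⟩
  rw [hHP, map_add, map_pow, aeval_X, aeval_toPoly] at hx
  rw [evalL_append, evalL_cons, evalL_nil, map_one, mul_zero, add_zero, mul_one, add_comm]
  exact hx

/-- `Γ_ℚ` commutes with evaluation of a rational coefficient list. [folklore] -/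
theorem smul_evalL (σ : absoluteGaloisGroup ℚ) (x : AlgebraicClosure ℚ) :
    ∀ l : List ℚ, σ • evalL x l = evalL (σ • x) l
  | [] => by simp
  | c :: l => by
    have ih := smul_evalL σ x l
    simp only [Field.absoluteGaloisGroup.smul_def] at ih ⊢
    have hc : absoluteGaloisGroup.toAlgEquiv ℚ σ (algebraMap ℚ (AlgebraicClosure ℚ) c) =
        algebraMap ℚ (AlgebraicClosure ℚ) c := (absoluteGaloisGroup.toAlgEquiv ℚ σ).commutes c
    rw [evalL_cons, evalL_cons, map_add, map_mul, hc, ih]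

/-- `Γ_ℚ` acts on affine points coordinatewise. [folklore] -/
theorem smul_some (W : WeierstrassCurve ℚ) (σ : absoluteGaloisGroup ℚ) {x y : AlgebraicClosure ℚ}
    (h : (W.baseChange (AlgebraicClosure ℚ)).toAffine.Nonsingular x y) {Q : W.geomPoints}
    (hQ : Q = Affine.Point.some x y h) :
    ∃ h' : (W.baseChange (AlgebraicClosure ℚ)).toAffine.Nonsingular (σ • x) (σ • y),
      σ • Q = Affine.Point.some (σ • x) (σ • y) h' :=
  ⟨_, by subst hQ; rfl⟩

end Facts

end KerPoly

end Summit.BirchSwinnertonDyer.BirchSwinnertonDyer.Rank2Sha
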